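import Summits.BirchSwinnertonDyer.BirchSwinnertonDyer.Theorems.ThetaPartnerAtTwoSignedControlAtTwoSignedLocalInjModP
import HarnessLib

/-!
# CYC (monogenicity of `E⁺(K_n·K_v)` modulo `p`) from a HONDA SYSTEM on the `ℤ_p`-tower: points `d_n ∈ E(K_n·K_v)`
# with Kobayashi's trace relations `Tr_{n+2/n+1} d_{n+2} = −d_n` which generate each layer modulo the previous one and
# modulo `p` — Kobayashi's Prop. 8.12 i) («`E⁺` is generated by the conjugates of the even Honda points») on the tree's
# objects, any `K`, `p`, `κ`, `ι` (route `ThetaPartnerAtTwo`, crux K4 `SignedControlAtTwo`, stmt-BirchSwinnertonDyer-20309,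
# line `eulerchar` v4, under the registered stub `stub_plusLocalInjTwo`)

Seat `prover-bsd-wall-tp2-p3-w3` (width seat 3/3). Sequel of `…SignedLocalInjModP` / `…PlusLocalInjOfCyclic` (INJ⁺@2 ⟸
CYC⁺@2 + LEV0@2). This file derives CYC⁺ from the shape in which the `±` local theory is PRODUCED in print (Kobayashi,
Invent. Math. 152 (2003) §8.4: Honda points `c_n`, Lemma 8.9 trace relations, Prop. 8.11 generation, Prop. 8.12) and in
which the flat road of crux 19097 consumes it at `2` (stub (5): a Δ-traced Honda system of Sprung 2012 Thm. 2.2 (2′)).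

WHAT (`M_n = E(K_n·K_v)`, `E⁺_n =` Kobayashi's plus points, `Tr_{n/m}` the tree's `localTraceOfEmb`; hypotheses:
(NT) no `p`-torsion in `E(K_∞·K_v)`; (IDX) each local layer step has degree `p`; a family `d : ℕ → E(K̄_v)` with
(L) `d_n ∈ M_n`, (TR) `Tr_{n+2/n+1} d_{n+2} = −d_n`, (GEN) `M_n ⊆ ℤ[Γ_{K_v}]·d_n + M_{n−1} + p·M_n` (`n ≥ 1`),
(GEN₀) `M_0 ⊆ ℤ·d_0 + p·M_0`):
* §1 bookkeeping: layer descent of `p^a`-divisibility; relative local indices divide `p^n`; **layer descent of the signed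
  condition** `mem_signedLocalPointsOfEmb_of_mem_layer` (`E^ε_n ∩ M_j ⊆ E^ε_j`); the odd layers collapse
  (`E⁺_{2j+1} ≤ E⁺_{2j}`); `Γ`-stability of orbit spans; traces of orbit spans.
* §2 `localTraceOfEmb_d_even_mem` — the even points satisfy the plus conditions: `d_{2j} ∈ E⁺_{2j}` (from (TR) by trace
  transitivity, Kobayashi Prop. 8.12 i) first half).
* §3 **`plusCyclic_even_of_honda`, `plusCyclic_of_honda`** — CYC⁺: for every `n`, `E⁺_n = ℤ[Γ_{K_v}]·d + p·E⁺_n` for ONE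
  `d ∈ E⁺_n` (namely `d_n`, resp. `d_{n−1}` for odd `n`). Induction on even `n`: for `x ∈ E⁺_n` write
  `x = B + P' + pR` (GEN); `pR = R' + Tr_{n/n−1}R` with `R' := pR − Tr_{n/n−1} R ∈ E⁺_n` (all its traces vanish); then
  `P' + Tr R ∈ E⁺_n ∩ M_{n−1} = E⁺_{n−2}` (descent + odd collapse) is handled by induction, and `R' ∈ p·E⁺_n + ℤ[Γ]·d_{n−2}`
  by (GEN) once more, (TR) and saturation; finally `d_{n−2} = −Tr d_n ∈ ℤ[Γ]·d_n`.

HONEST FRAMING: THEOREMS ONLY (no definition, no named fact, no `sorry`), route-independent; nothing about any curve is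
asserted beyond the displayed hypotheses; closes no item; BSD is not proved by any of this.

References: [Kobayashi2003] S. Kobayashi, Invent. Math. 152 (2003), §2 p. 4, Lemma 8.9, Prop. 8.11, Prop. 8.12 (pp. 16–18);
[Sprung2012] F. Sprung, J. Number Theory 132 (2012), Thm. 2.2, Lemma 2.3; [BDKim2013] B. D. Kim, J. Aust. Math. Soc. 95
(2013), proof of Cor. 3.15.
-/

set_option autoImplicit false
-- the Theorems namespace of this sub repeats the summit name by design (D-0017 nested layout)
set_option linter.dupNamespace false

noncomputable section

open scoped Classical

open Finset

namespace Summit.BirchSwinnertonDyer.BirchSwinnertonDyer.Theorems.SignedEC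

open Literature.NumberTheory.EllipticCurves Literature.NumberTheory.GaloisRepresentations
  WeierstrassCurve ZpExtension Literature.NumberTheory.EllipticCurves.Kobayashi2003
  Literature.NumberTheory.EllipticCurves.Sprung2012 Summit.BirchSwinnertonDyer.Rank1Residual.Additive

universe u

variable {K : Type u} [Field K] (W : WeierstrassCurve K) {p : ℕ} [Fact p.Prime] (κ : ZpExtension K p)
  {E : Type u} [Field E] [Algebra K E] (ι : AlgebraicClosure K →ₐ[K] AlgebraicClosure E)

/-! ## §1 Bookkeeping -/

/-- Layer descent of `p^a`-divisibility (no `p`-torsion): a tower point `y` with `p^a • y ∈ E(K_m·K_v)` lies in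
`E(K_m·K_v)`. [cite: Kobayashi2003, §2 p. 4 and Prop. 8.7 (p. 16)] -/
theorem mem_localLayerPointsOfEmb_of_pow_nsmul_mem
    (hnt : ∀ P ∈ localTowerPointsOfEmb κ ι W, p • P = 0 → P = 0) (m : ℕ) {a : ℕ}
    {y : localPoints W E} (hy : y ∈ localTowerPointsOfEmb κ ι W)
    (hpy : p ^ a • y ∈ localLayerPointsOfEmb κ ι W m) : y ∈ localLayerPointsOfEmb κ ι W m := by
  induction a generalizing y with
  | zero => rwa [pow_zero, one_smul] at hpy
  | succ a ih =>
    refine ih hy (mem_localLayerPointsOfEmb_of_nsmul_mem W κ ι hnt m (AddSubgroup.nsmul_mem _ hy _) ?_)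
    rwa [smul_smul, ← pow_succ']

/-- Layer descent of divisibility by a divisor of `p^a`. [cite: Kobayashi2003, §2 p. 4] -/
theorem mem_localLayerPointsOfEmb_of_dvd_pow_nsmul_mem
    (hnt : ∀ P ∈ localTowerPointsOfEmb κ ι W, p • P = 0 → P = 0) (m : ℕ) {a c : ℕ} (hc : c ∣ p ^ a)
    {y : localPoints W E} (hy : y ∈ localTowerPointsOfEmb κ ι W)
    (hcy : c • y ∈ localLayerPointsOfEmb κ ι W m) : y ∈ localLayerPointsOfEmb κ ι W m := by
  obtain ⟨e, he⟩ := hc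
  refine mem_localLayerPointsOfEmb_of_pow_nsmul_mem W κ ι hnt m (a := a) hy ?_
  rw [he, mul_comm, mul_smul]
  exact AddSubgroup.nsmul_mem _ hcy _

/-- The relative index of two local layer subgroups divides `p^n`. [folklore] -/
theorem index_subgroupOf_localLayerSubgroupOfEmb_dvd {j n : ℕ} (hjn : j ≤ n) :
    ((localLayerSubgroupOfEmb κ ι n).subgroupOf (localLayerSubgroupOfEmb κ ι j)).index ∣ p ^ n :=
  (Subgroup.relIndex_dvd_index_of_le (localLayerSubgroupOfEmb_antitone κ ι hjn)).trans
    (index_localLayerSubgroupOfEmb_dvd κ ι n)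

/-- **Layer descent of the signed condition**: a point of `E^ε(K_n·K_v)` lying in `E(K_j·K_v)`, `j ≤ n`, lies in
`E^ε(K_j·K_v)` — each trace `Tr_{n/m+1} P = [K_n·K_v : K_j·K_v] · Tr_{j/m+1} P` and layer descent of `p`-power
divisibility. [cite: Kobayashi2003, proof of Prop. 8.12 (p. 18)] -/
theorem mem_signedLocalPointsOfEmb_of_mem_layer
    (hnt : ∀ P ∈ localTowerPointsOfEmb κ ι W, p • P = 0 → P = 0) (ε : ℤˣ) {j n : ℕ} (hjn : j ≤ n)
    {P : localPoints W E} (hP : P ∈ signedLocalPointsOfEmb κ ι W ε n)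
    (hPj : P ∈ localLayerPointsOfEmb κ ι W j) : P ∈ signedLocalPointsOfEmb κ ι W ε j := by
  rw [mem_signedLocalPointsOfEmb_iff] at hP ⊢
  refine ⟨hPj, fun m hm hε ↦ ?_⟩
  have h1 := hP.2 m (lt_of_lt_of_le hm hjn) hε
  rw [localTraceOfEmb_eq_localPairTraceOfEmb,
    localPairTraceOfEmb_of_mem_mid κ.layerSubgroup ι W κ.layerSubgroup_antitone (Nat.succ_le_of_lt hm) hjn hPj,
    ← localTraceOfEmb_eq_localPairTraceOfEmb] at h1
  exact mem_localLayerPointsOfEmb_of_dvd_pow_nsmul_mem W κ ι hnt m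
    (index_subgroupOf_localLayerSubgroupOfEmb_dvd κ ι hjn)
    (localLayerPointsOfEmb_le_localTowerPointsOfEmb κ ι W (m + 1) (localTraceOfEmb_mem_of_mem κ ι W (m + 1) j hPj))
    h1

/-- **The odd plus layers collapse**: `E⁺(K_{2j+1}·K_v) ≤ E⁺(K_{2j}·K_v)` (the condition at the even index `2j` says
`P ∈ E(K_{2j}·K_v)`; then layer descent). [cite: Kobayashi2003, Def. 1.1 and proof of Prop. 8.12 (p. 18)] -/
theorem signedLocalPointsOfEmb_one_odd_le
    (hnt : ∀ P ∈ localTowerPointsOfEmb κ ι W, p • P = 0 → P = 0) (j : ℕ) :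
    signedLocalPointsOfEmb κ ι W 1 (2 * j + 1) ≤ signedLocalPointsOfEmb κ ι W 1 (2 * j) := by
  intro P hP
  have hP' := hP
  rw [mem_signedLocalPointsOfEmb_one_iff] at hP'
  have h := hP'.2 (2 * j) (by omega) (even_two_mul j)
  rw [show 2 * j + 1 = 2 * j + 1 from rfl, localTraceOfEmb_self_of_mem κ ι W (2 * j + 1) hP'.1] at h
  exact mem_signedLocalPointsOfEmb_of_mem_layer W κ ι hnt 1 (by omega) hP h

/-- The span of the `Γ_{K_v}`-orbit of a point is `Γ_{K_v}`-stable. [folklore] -/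
theorem smul_mem_closure_orbit (d : localPoints W E) (τ : Field.absoluteGaloisGroup E) {x : localPoints W E}
    (hx : x ∈ AddSubgroup.closure (Set.range fun σ : Field.absoluteGaloisGroup E ↦ σ • d)) :
    τ • x ∈ AddSubgroup.closure (Set.range fun σ : Field.absoluteGaloisGroup E ↦ σ • d) := by
  induction hx using AddSubgroup.closure_induction with
  | mem y hy =>
    obtain ⟨σ, rfl⟩ := hy
    rw [smul_smul]
    exact AddSubgroup.subset_closure ⟨τ * σ, rfl⟩
  | zero => rw [smul_zero]; exact AddSubgroup.zero_mem _
  | add y z _ _ hy hz => rw [smul_add]; exact AddSubgroup.add_mem _ hy hz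
  | neg y _ hy => rw [smul_neg]; exact AddSubgroup.neg_mem _ hy

/-- Orbit spans are monotone under membership: if `d' ∈ ⟨Γ·d⟩` then `⟨Γ·d'⟩ ≤ ⟨Γ·d⟩`. [folklore] -/
theorem closure_orbit_le_of_mem (d : localPoints W E) {d' : localPoints W E}
    (hd' : d' ∈ AddSubgroup.closure (Set.range fun σ : Field.absoluteGaloisGroup E ↦ σ • d)) :
    AddSubgroup.closure (Set.range fun σ : Field.absoluteGaloisGroup E ↦ σ • d') ≤
      AddSubgroup.closure (Set.range fun σ : Field.absoluteGaloisGroup E ↦ σ • d) := by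
  refine (AddSubgroup.closure_le _).2 ?_
  rintro _ ⟨σ, rfl⟩
  exact smul_mem_closure_orbit W d σ hd'

/-- The orbit span of a point of `E^ε(K_n·K_v)` lies in `E^ε(K_n·K_v)` (`Γ_{K_v}`-stability of the signed groups).
[cite: Kobayashi2003, Prop. 8.12 i) (p. 17)] -/
theorem closure_orbit_le_signedLocalPointsOfEmb (ε : ℤˣ) (n : ℕ) {d : localPoints W E}
    (hd : d ∈ signedLocalPointsOfEmb κ ι W ε n) :
    AddSubgroup.closure (Set.range fun σ : Field.absoluteGaloisGroup E ↦ σ • d) ≤ signedLocalPointsOfEmb κ ι W ε n := by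
  refine (AddSubgroup.closure_le _).2 ?_
  rintro _ ⟨σ, rfl⟩
  show σ • d ∈ signedLocalPointsOfEmb κ ι W ε n
  rw [signedLocalPointsOfEmb_eq_towerSigned] at hd ⊢
  exact smul_mem_towerSignedLocalPointsOfEmb κ.layerSubgroup ι W ε n σ hd

/-- The trace `Tr_{n/m} d` lies in the orbit span of `d ∈ E(K_n·K_v)` (it is a sum of conjugates).
[cite: Kobayashi2003, Def. 1.1 (the trace map)] -/
theorem localTraceOfEmb_mem_closure_orbit (m n : ℕ) (d : localPoints W E) :
    localTraceOfEmb κ ι W m n d ∈ AddSubgroup.closure (Set.range fun σ : Field.absoluteGaloisGroup E ↦ σ • d) := by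
  haveI : Fintype (localLayerSubgroupOfEmb κ ι m ⧸
      (localLayerSubgroupOfEmb κ ι n).subgroupOf (localLayerSubgroupOfEmb κ ι m)) := Fintype.ofFinite _
  rw [localTraceOfEmb_apply]
  exact sum_mem fun q _ ↦ AddSubgroup.subset_closure ⟨_, rfl⟩

/-- **Traces of orbit spans**: if `Tr_{n+2/n+1} d = −d'` (with `d ∈ E(K_{n+2}·K_v)`) then `Tr_{n+2/n+1}` maps the orbit
span of `d` into the orbit span of `d'` (the trace commutes with `Γ_{K_v}`, normal tower).
[cite: Kobayashi2003, Lemma 8.9 and Prop. 8.12 i)] -/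
theorem localTraceOfEmb_mem_closure_orbit_of_traceRel (n : ℕ) {d d' : localPoints W E}
    (hd : d ∈ localLayerPointsOfEmb κ ι W (n + 2)) (htr : localTraceOfEmb κ ι W (n + 1) (n + 2) d = -d')
    {x : localPoints W E} (hx : x ∈ AddSubgroup.closure (Set.range fun σ : Field.absoluteGaloisGroup E ↦ σ • d)) :
    localTraceOfEmb κ ι W (n + 1) (n + 2) x ∈
      AddSubgroup.closure (Set.range fun σ : Field.absoluteGaloisGroup E ↦ σ • d') := by
  induction hx using AddSubgroup.closure_induction with
  | mem y hy =>
    obtain ⟨σ, rfl⟩ := hy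
    rw [localTraceOfEmb_eq_localPairTraceOfEmb,
      ← smul_localPairTraceOfEmb_of_normal ι W (κ.layerSubgroup (n + 1)) (κ.layerSubgroup (n + 2)) σ hd,
      ← localTraceOfEmb_eq_localPairTraceOfEmb, htr, smul_neg]
    exact AddSubgroup.neg_mem _ (AddSubgroup.subset_closure ⟨σ, rfl⟩)
  | zero => rw [map_zero]; exact AddSubgroup.zero_mem _
  | add y z _ _ hy hz => rw [map_add]; exact AddSubgroup.add_mem _ hy hz
  | neg y _ hy => rw [map_neg]; exact AddSubgroup.neg_mem _ hy

/-! ## §2 The even Honda points satisfy the plus conditions -/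

/-- For `d` with (L) and (TR): `Tr_{2j/2i+1} d_{2j} ∈ E(K_{2i}·K_v)` for `i < j` (trace transitivity down the even chain).
[cite: Kobayashi2003, Lemma 8.9, Prop. 8.12 i)] -/
theorem localTraceOfEmb_d_even_mem (d : ℕ → localPoints W E) (hd : ∀ m, d m ∈ localLayerPointsOfEmb κ ι W m)
    (htr : ∀ m, localTraceOfEmb κ ι W (m + 1) (m + 2) (d (m + 2)) = -d m) :
    ∀ j i : ℕ, i < j → localTraceOfEmb κ ι W (2 * i + 1) (2 * j) (d (2 * j)) ∈ localLayerPointsOfEmb κ ι W (2 * i) := by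
  intro j
  induction j with
  | zero => intro i hi; omega
  | succ j ih =>
    intro i hi
    rcases Nat.lt_succ_iff_lt_or_eq.1 hi with hlt | rfl
    · -- `i < j`: go through the layer `2j+1`
      have hd2 : d (2 * j + 2) ∈ localFixedPointsOfEmb ι W (κ.layerSubgroup (2 * j + 2)) := hd (2 * j + 2)
      have htr' : localPairTraceOfEmb ι W (κ.layerSubgroup (2 * j + 1)) (κ.layerSubgroup (2 * j + 2))
          (d (2 * j + 2)) = -d (2 * j) := by
        have := htr (2 * j); rwa [localTraceOfEmb_eq_localPairTraceOfEmb] at this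
      rw [show 2 * (j + 1) = 2 * j + 2 by ring, localTraceOfEmb_eq_localPairTraceOfEmb,
        localPairTraceOfEmb_trans ι W (κ.layerSubgroup_antitone (show 2 * i + 1 ≤ 2 * j + 1 by omega))
          (κ.layerSubgroup_antitone (show 2 * j + 1 ≤ 2 * j + 2 by omega)) hd2,
        htr', map_neg,
        localPairTraceOfEmb_of_mem_mid κ.layerSubgroup ι W κ.layerSubgroup_antitone
          (show 2 * i + 1 ≤ 2 * j by omega) (show 2 * j ≤ 2 * j + 1 by omega) (hd (2 * j)),
        ← localTraceOfEmb_eq_localPairTraceOfEmb]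
      exact AddSubgroup.neg_mem _ (AddSubgroup.nsmul_mem _ (ih i hlt) _)
    · -- `i = j`: the relation itself
      rw [show 2 * (i + 1) = 2 * i + 2 by ring, htr (2 * i)]
      exact AddSubgroup.neg_mem _ (hd (2 * i))

/-- **`d_{2j} ∈ E⁺(K_{2j}·K_v)`** (Kobayashi Prop. 8.12 i), first half, on the `ℤ_p`-tower).
[cite: Kobayashi2003, Prop. 8.12 i) (p. 17)] -/
theorem d_even_mem_signedLocalPointsOfEmb_one (d : ℕ → localPoints W E)
    (hd : ∀ m, d m ∈ localLayerPointsOfEmb κ ι W m)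
    (htr : ∀ m, localTraceOfEmb κ ι W (m + 1) (m + 2) (d (m + 2)) = -d m) (j : ℕ) :
    d (2 * j) ∈ signedLocalPointsOfEmb κ ι W 1 (2 * j) := by
  rw [mem_signedLocalPointsOfEmb_one_iff]
  refine ⟨hd (2 * j), fun m hm heven ↦ ?_⟩
  obtain ⟨i, hi⟩ := heven
  have him : m = 2 * i := by omega
  subst him
  exact localTraceOfEmb_d_even_mem W κ ι d hd htr j i (by omega)

/-! ## §3 CYC⁺ from the Honda system -/

/-- **CYC⁺ at the even layers from a Honda system** (Kobayashi Prop. 8.12 i) READ on the `ℤ_p`-tower, modulo `p`): under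
(NT), (IDX), (L), (TR), (GEN), (GEN₀), for every `j` and every `x ∈ E⁺(K_{2j}·K_v)` there are `B` in the span of the
`Γ_{K_v}`-orbit of `d_{2j}` and `b ∈ E⁺(K_{2j}·K_v)` with `x = B + p • b`. [cite: Kobayashi2003, Prop. 8.12 (pp. 17–18)] -/
theorem plusCyclic_even_of_honda
    (hnt : ∀ P ∈ localTowerPointsOfEmb κ ι W, p • P = 0 → P = 0)
    (hidx : ∀ m : ℕ, ((localLayerSubgroupOfEmb κ ι (m + 1)).subgroupOf (localLayerSubgroupOfEmb κ ι m)).index = p)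
    (d : ℕ → localPoints W E) (hd : ∀ m, d m ∈ localLayerPointsOfEmb κ ι W m)
    (htr : ∀ m, localTraceOfEmb κ ι W (m + 1) (m + 2) (d (m + 2)) = -d m)
    (hgen : ∀ m : ℕ, 1 ≤ m → ∀ P ∈ localLayerPointsOfEmb κ ι W m,
      ∃ B ∈ AddSubgroup.closure (Set.range fun σ : Field.absoluteGaloisGroup E ↦ σ • d m),
        ∃ P' ∈ localLayerPointsOfEmb κ ι W (m - 1), ∃ R ∈ localLayerPointsOfEmb κ ι W m, P = B + P' + p • R)
    (hgen0 : ∀ P ∈ localLayerPointsOfEmb κ ι W 0, ∃ a : ℤ, ∃ R ∈ localLayerPointsOfEmb κ ι W 0, P = a • d 0 + p • R) :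
    ∀ j : ℕ, ∀ x ∈ signedLocalPointsOfEmb κ ι W 1 (2 * j),
      ∃ B ∈ AddSubgroup.closure (Set.range fun σ : Field.absoluteGaloisGroup E ↦ σ • d (2 * j)),
        ∃ b ∈ signedLocalPointsOfEmb κ ι W 1 (2 * j), x = B + p • b := by
  intro j
  induction j with
  | zero =>
    intro x hx
    rw [Nat.mul_zero, signedLocalPointsOfEmb_zero] at hx ⊢
    obtain ⟨a, R, hR, hxa⟩ := hgen0 x hx
    have h1 : d 0 ∈ Set.range (fun σ : Field.absoluteGaloisGroup E ↦ σ • d 0) := ⟨1, one_smul _ _⟩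
    exact ⟨a • d 0, AddSubgroup.zsmul_mem _ (AddSubgroup.subset_closure h1) _, R, hR, hxa⟩
  | succ j ih =>
    intro x hx
    -- notation: `n = 2j+2`, the plus group at `n`, saturation and stability facts
    have hn : 2 * (j + 1) = 2 * j + 2 := by ring
    rw [hn] at hx ⊢
    have hdn : d (2 * j + 2) ∈ signedLocalPointsOfEmb κ ι W 1 (2 * j + 2) := by
      have := d_even_mem_signedLocalPointsOfEmb_one W κ ι d hd htr (j + 1); rwa [hn] at this
    have hd2j : d (2 * j) ∈ signedLocalPointsOfEmb κ ι W 1 (2 * j) :=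
      d_even_mem_signedLocalPointsOfEmb_one W κ ι d hd htr j
    have hmono : signedLocalPointsOfEmb κ ι W 1 (2 * j) ≤ signedLocalPointsOfEmb κ ι W 1 (2 * j + 2) :=
      signedLocalPointsOfEmb_mono κ ι W 1 (by omega)
    have hAMn : signedLocalPointsOfEmb κ ι W 1 (2 * j + 2) ≤ localLayerPointsOfEmb κ ι W (2 * j + 2) :=
      signedLocalPointsOfEmb_le κ ι W 1 _
    have hMnM : localLayerPointsOfEmb κ ι W (2 * j + 2) ≤ localTowerPointsOfEmb κ ι W :=
      localLayerPointsOfEmb_le_localTowerPointsOfEmb κ ι W _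
    have hclo_n := closure_orbit_le_signedLocalPointsOfEmb W κ ι 1 (2 * j + 2) hdn
    have hclo_2j := closure_orbit_le_signedLocalPointsOfEmb W κ ι 1 (2 * j) hd2j
    -- `d_{2j} = -Tr d_n` lies in the orbit span of `d_n`
    have hd2j_orbit : d (2 * j) ∈ AddSubgroup.closure
        (Set.range fun σ : Field.absoluteGaloisGroup E ↦ σ • d (2 * j + 2)) := by
      have h := localTraceOfEmb_mem_closure_orbit W κ ι (2 * j + 1) (2 * j + 2) (d (2 * j + 2))
      rw [htr (2 * j)] at h
      have := AddSubgroup.neg_mem _ h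
      rwa [neg_neg] at this
    have horbit_le := closure_orbit_le_of_mem W (d (2 * j + 2)) hd2j_orbit
    -- the trace on points of the layer `n-1` is multiplication by `p`
    have htrp : ∀ Q ∈ localLayerPointsOfEmb κ ι W (2 * j + 1),
        localTraceOfEmb κ ι W (2 * j + 1) (2 * j + 2) Q = p • Q := fun Q hQ ↦ by
      rw [localTraceOfEmb_apply_of_mem_lower κ ι W (2 * j + 1) (2 * j + 2) hQ, hidx (2 * j + 1)]
    -- (GEN) for `x`
    obtain ⟨B, hB, P', hP', R, hR, hxe⟩ := hgen (2 * j + 2) (by omega) x (hAMn hx)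
    rw [show 2 * j + 2 - 1 = 2 * j + 1 by omega] at hP'
    have hTrR : localTraceOfEmb κ ι W (2 * j + 1) (2 * j + 2) R ∈ localLayerPointsOfEmb κ ι W (2 * j + 1) :=
      localTraceOfEmb_mem_of_mem κ ι W (2 * j + 1) (2 * j + 2) hR
    -- `R' := p R − Tr R ∈ E⁺_n`
    set R' : localPoints W E := p • R - localTraceOfEmb κ ι W (2 * j + 1) (2 * j + 2) R with hR'def
    have hR'top : localTraceOfEmb κ ι W (2 * j + 1) (2 * j + 2) R' = 0 := by
      rw [hR'def, map_sub, map_nsmul, htrp _ hTrR, sub_self]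
    have hR'n : R' ∈ localLayerPointsOfEmb κ ι W (2 * j + 2) :=
      sub_mem (AddSubgroup.nsmul_mem _ hR _) (localLayerPointsOfEmb_mono κ ι W (by omega) hTrR)
    have hR'plus : R' ∈ signedLocalPointsOfEmb κ ι W 1 (2 * j + 2) := by
      rw [mem_signedLocalPointsOfEmb_one_iff]
      refine ⟨hR'n, fun m hm heven ↦ ?_⟩
      have hm' : m + 1 ≤ 2 * j + 1 := by obtain ⟨i, hi⟩ := heven; omega
      have hR'fix : R' ∈ localFixedPointsOfEmb ι W (κ.layerSubgroup (2 * j + 2)) := hR'n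
      have hR'top' : localPairTraceOfEmb ι W (κ.layerSubgroup (2 * j + 1)) (κ.layerSubgroup (2 * j + 2)) R' = 0 := by
        have := hR'top; rwa [localTraceOfEmb_eq_localPairTraceOfEmb] at this
      rw [localTraceOfEmb_eq_localPairTraceOfEmb,
        localPairTraceOfEmb_trans ι W (κ.layerSubgroup_antitone hm')
          (κ.layerSubgroup_antitone (show 2 * j + 1 ≤ 2 * j + 2 by omega)) hR'fix,
        hR'top', map_zero]
      exact AddSubgroup.zero_mem _
    have hpR : p • R = R' + localTraceOfEmb κ ι W (2 * j + 1) (2 * j + 2) R := by rw [hR'def, sub_add_cancel]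
    -- `P'' := P' + Tr R ∈ E⁺_n ∩ M_{n-1} = E⁺_{2j}`
    have hP''plus : P' + localTraceOfEmb κ ι W (2 * j + 1) (2 * j + 2) R ∈ signedLocalPointsOfEmb κ ι W 1 (2 * j) := by
      have h1 : P' + localTraceOfEmb κ ι W (2 * j + 1) (2 * j + 2) R = x - B - R' := by
        rw [hxe, hpR]; abel
      have h2 : P' + localTraceOfEmb κ ι W (2 * j + 1) (2 * j + 2) R ∈ signedLocalPointsOfEmb κ ι W 1 (2 * j + 2) := by
        rw [h1]; exact sub_mem (sub_mem hx (hclo_n hB)) hR'plus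
      have h3 : P' + localTraceOfEmb κ ι W (2 * j + 1) (2 * j + 2) R ∈ signedLocalPointsOfEmb κ ι W 1 (2 * j + 1) :=
        mem_signedLocalPointsOfEmb_of_mem_layer W κ ι hnt 1 (by omega) h2 (add_mem hP' hTrR)
      exact signedLocalPointsOfEmb_one_odd_le W κ ι hnt j h3
    obtain ⟨B₂, hB₂, b₂, hb₂, hP''e⟩ := ih _ hP''plus
    -- `R' ∈ p • E⁺_n + ⟨Γ·d_{2j}⟩`: (GEN) for `R`
    obtain ⟨B₃, hB₃, Q, hQ, R₃, hR₃, hRe⟩ := hgen (2 * j + 2) (by omega) R hR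
    rw [show 2 * j + 2 - 1 = 2 * j + 1 by omega] at hQ
    have hTrB₃ : localTraceOfEmb κ ι W (2 * j + 1) (2 * j + 2) B₃ ∈
        AddSubgroup.closure (Set.range fun σ : Field.absoluteGaloisGroup E ↦ σ • d (2 * j)) :=
      localTraceOfEmb_mem_closure_orbit_of_traceRel W κ ι (2 * j) (hd (2 * j + 2)) (htr (2 * j)) hB₃
    set T : localPoints W E := B₃ + p • R₃ - localTraceOfEmb κ ι W (2 * j + 1) (2 * j + 2) R₃ with hTdef
    have hTR' : R' = p • T - localTraceOfEmb κ ι W (2 * j + 1) (2 * j + 2) B₃ := by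
      have hTrRe : localTraceOfEmb κ ι W (2 * j + 1) (2 * j + 2) R =
          localTraceOfEmb κ ι W (2 * j + 1) (2 * j + 2) B₃ + p • Q +
            p • localTraceOfEmb κ ι W (2 * j + 1) (2 * j + 2) R₃ := by
        rw [hRe, map_add, map_add, map_nsmul, htrp Q hQ]
      rw [hR'def, hTrRe, hTdef, hRe, smul_sub, smul_add, smul_add, smul_add]
      abel
    have hTM : T ∈ localTowerPointsOfEmb κ ι W :=
      hMnM (sub_mem (add_mem ((hclo_n.trans hAMn) hB₃) (AddSubgroup.nsmul_mem _ hR₃ _))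
        (localLayerPointsOfEmb_mono κ ι W (by omega) (localTraceOfEmb_mem_of_mem κ ι W _ _ hR₃)))
    have hTplus : T ∈ signedLocalPointsOfEmb κ ι W 1 (2 * j + 2) := by
      refine mem_signedLocalPointsOfEmb_of_nsmul_mem W κ ι hnt 1 (2 * j + 2) hTM ?_
      have e : p • T = R' + localTraceOfEmb κ ι W (2 * j + 1) (2 * j + 2) B₃ := by rw [hTR', sub_add_cancel]
      rw [e]; exact add_mem hR'plus (hmono (hclo_2j hTrB₃))
    -- assemble
    refine ⟨B + B₂ - localTraceOfEmb κ ι W (2 * j + 1) (2 * j + 2) B₃, ?_, b₂ + T, add_mem (hmono hb₂) hTplus, ?_⟩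
    · exact sub_mem (add_mem hB (horbit_le hB₂)) (horbit_le hTrB₃)
    · calc x = B + (P' + localTraceOfEmb κ ι W (2 * j + 1) (2 * j + 2) R) + R' := by rw [hxe, hpR]; abel
        _ = B + (B₂ + p • b₂) + (p • T - localTraceOfEmb κ ι W (2 * j + 1) (2 * j + 2) B₃) := by rw [hP''e, hTR']
        _ = B + B₂ - localTraceOfEmb κ ι W (2 * j + 1) (2 * j + 2) B₃ + p • (b₂ + T) := by rw [smul_add]; abel

/-- **CYC⁺ at every layer from a Honda system**: under (NT), (IDX), (L), (TR), (GEN), (GEN₀), for every `n` there is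
`d ∈ E⁺(K_n·K_v)` (namely `d_n` for even `n`, `d_{n−1}` for odd `n`) with `E⁺(K_n·K_v) = ℤ[Γ_{K_v}]·d + p·E⁺(K_n·K_v)`
— the hypothesis (CYC) of `modP_of_cyclic` / `invariantsLift_of_cyclic` / `plusLocalInj_two_of_cyclicModTwo`.
[cite: Kobayashi2003, Prop. 8.12 (pp. 17–18)] -/
theorem plusCyclic_of_honda
    (hnt : ∀ P ∈ localTowerPointsOfEmb κ ι W, p • P = 0 → P = 0)
    (hidx : ∀ m : ℕ, ((localLayerSubgroupOfEmb κ ι (m + 1)).subgroupOf (localLayerSubgroupOfEmb κ ι m)).index = p)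
    (d : ℕ → localPoints W E) (hd : ∀ m, d m ∈ localLayerPointsOfEmb κ ι W m)
    (htr : ∀ m, localTraceOfEmb κ ι W (m + 1) (m + 2) (d (m + 2)) = -d m)
    (hgen : ∀ m : ℕ, 1 ≤ m → ∀ P ∈ localLayerPointsOfEmb κ ι W m,
      ∃ B ∈ AddSubgroup.closure (Set.range fun σ : Field.absoluteGaloisGroup E ↦ σ • d m),
        ∃ P' ∈ localLayerPointsOfEmb κ ι W (m - 1), ∃ R ∈ localLayerPointsOfEmb κ ι W m, P = B + P' + p • R)
    (hgen0 : ∀ P ∈ localLayerPointsOfEmb κ ι W 0, ∃ a : ℤ, ∃ R ∈ localLayerPointsOfEmb κ ι W 0, P = a • d 0 + p • R) :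
    ∀ n : ℕ, ∃ dd ∈ signedLocalPointsOfEmb κ ι W 1 n, ∀ x ∈ signedLocalPointsOfEmb κ ι W 1 n,
      ∃ B ∈ AddSubgroup.closure (Set.range fun σ : Field.absoluteGaloisGroup E ↦ σ • dd),
        ∃ b ∈ signedLocalPointsOfEmb κ ι W 1 n, x = B + p • b := by
  intro n
  rcases Nat.even_or_odd n with ⟨j, hj⟩ | ⟨j, hj⟩
  · have hn : n = 2 * j := by omega
    subst hn
    exact ⟨d (2 * j), d_even_mem_signedLocalPointsOfEmb_one W κ ι d hd htr j,
      plusCyclic_even_of_honda W κ ι hnt hidx d hd htr hgen hgen0 j⟩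
  · subst hj
    have hle := signedLocalPointsOfEmb_one_odd_le W κ ι hnt j
    have hmono : signedLocalPointsOfEmb κ ι W 1 (2 * j) ≤ signedLocalPointsOfEmb κ ι W 1 (2 * j + 1) :=
      signedLocalPointsOfEmb_mono κ ι W 1 (by omega)
    refine ⟨d (2 * j), hmono (d_even_mem_signedLocalPointsOfEmb_one W κ ι d hd htr j), fun x hx ↦ ?_⟩
    obtain ⟨B, hB, b, hb, hxe⟩ := plusCyclic_even_of_honda W κ ι hnt hidx d hd htr hgen hgen0 j x (hle hx)
    exact ⟨B, hB, b, hmono hb, hxe⟩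

end Summit.BirchSwinnertonDyer.BirchSwinnertonDyer.Theorems.SignedEC

end
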